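import Mathlib
import Summits.Ventures.HodgeRepro2.T5NormGroupOpen

/-!
# Every quadratic character of `Kvˣ` is continuous (automatic continuity)

`Kv = v.adicCompletion K` at a finite place `v` of the number field `K`.

* `exists_sq_eq_of_val_sub_one_lt_val_four`: a unit `u ∈ Kvˣ` with `v (u − 1) < v 4` is a SQUARE in
  `Kvˣ` (`T5NormGroupOpen`'s Hensel lemma: `u = (1 + 2a)²`, `a ∈ 𝔪`);
* `mem_nhds_one_of_forall_sq_mem`, `isOpen_of_forall_sq_mem`: a subgroup containing every square
  contains the open set `{u | v (u − 1) < v 4}`, hence is open; **`isOpen_of_index_two (H : Subgroup Kvˣ)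
  (hH : H.index = 2) : IsOpen H`** (`Subgroup.sq_mem_of_index_two`);
* **`continuous_signChar (H) (hH)`** and **`continuous_of_index_two_ker (χ : Kvˣ →* ℤˣ)`**: every
  homomorphism `Kvˣ →* ℤˣ` is continuous — its kernel has index `1` or `2`.

So the local quadratic characters of the route (the `η_v` of `T5LocalNormCharacter`, and every
character of `F_v^×` of order `≤ 2` that the N5 lane manipulates) are continuous automatically;
no ramification case analysis is needed for their continuity.

Declaration per README §8(d): «uses an L-value-free non-vanishing device: NO».
-/

namespace Summit.Ventures.HodgeRepro2.T5QuadraticCharactersContinuous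

open IsDedekindDomain HeightOneSpectrum IsLocalRing WithZero

variable {K : Type*} [Field K] [NumberField K] (v : HeightOneSpectrum (NumberField.RingOfIntegers K))

/-- A unit `u` with `v (u − 1) < v 4` is a square in `Kvˣ`. -/
theorem exists_sq_eq_of_val_sub_one_lt_val_four (u : (adicCompletion K v)ˣ)
    (hu : Valued.v ((u : adicCompletion K v) - 1) < Valued.v (4 : adicCompletion K v)) :
    ∃ y : (adicCompletion K v)ˣ, y ^ 2 = u := by
  have h4 : (4 : adicCompletion K v) ≠ 0 := by
    intro h
    rw [h, map_zero] at hu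
    exact absurd hu (not_lt.mpr zero_le)
  have h4v : 0 < Valued.v (4 : adicCompletion K v) :=
    lt_of_le_of_ne zero_le (Ne.symm ((Valuation.ne_zero_iff _).mpr h4))
  set t : adicCompletion K v := ((u : adicCompletion K v) - 1) / 4 with ht
  have htv : Valued.v t < 1 := by
    rw [ht, map_div₀]
    exact (div_lt_one₀ h4v).mpr hu
  have htO : t ∈ adicCompletionIntegers K v := by
    rw [mem_adicCompletionIntegers]; exact htv.le
  have htm : (⟨t, htO⟩ : adicCompletionIntegers K v) ∈ maximalIdeal (adicCompletionIntegers K v) :=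
    (T5AdicCompletionResidueField.mem_maximalIdeal_iff v _).mpr htv
  have huO : (u : adicCompletion K v) ∈ adicCompletionIntegers K v := by
    rw [mem_adicCompletionIntegers]
    have e : (u : adicCompletion K v) = ((u : adicCompletion K v) - 1) + 1 := (sub_add_cancel _ _).symm
    rw [e]
    exact (Valuation.map_add _ _ _).trans
      (max_le (hu.le.trans (T5NormGroupOpen.val_four_le_one v)) (by rw [map_one]))
  have hueq : (⟨(u : adicCompletion K v), huO⟩ : adicCompletionIntegers K v) = 1 + 4 * ⟨t, htO⟩ := by
    apply Subtype.ext
    show (u : adicCompletion K v) = 1 + 4 * t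
    rw [ht, mul_div_cancel₀ _ h4]
    ring
  obtain ⟨a, -, ha⟩ := T5NormGroupOpen.exists_sq_eq_of_sub_one_mem_four_mul v _ ⟨⟨t, htO⟩, htm, hueq⟩
  have hy : (((1 + 2 * a : adicCompletionIntegers K v) : adicCompletionIntegers K v) :
      adicCompletion K v) ^ 2 = (u : adicCompletion K v) := by
    have h : (((1 + 2 * a) ^ 2 : adicCompletionIntegers K v) : adicCompletion K v) =
        (u : adicCompletion K v) := congrArg Subtype.val ha
    rw [← h]
    push_cast
    ring
  have hy0 : (((1 + 2 * a : adicCompletionIntegers K v) : adicCompletionIntegers K v) :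
      adicCompletion K v) ≠ 0 := by
    intro h0
    rw [h0, zero_pow two_ne_zero] at hy
    exact u.ne_zero hy.symm
  exact ⟨Units.mk0 _ hy0, Units.ext (by rw [Units.val_pow_eq_pow_val, Units.val_mk0, hy])⟩

/-- A subgroup of `Kvˣ` containing every square is a neighbourhood of `1`. -/
theorem mem_nhds_one_of_forall_sq_mem (H : Subgroup (adicCompletion K v)ˣ)
    (hH : ∀ x : (adicCompletion K v)ˣ, x ^ 2 ∈ H) :
    (H : Set (adicCompletion K v)ˣ) ∈ nhds (1 : (adicCompletion K v)ˣ) := by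
  haveI : CharZero (adicCompletion K v) :=
    charZero_of_injective_algebraMap (algebraMap K (adicCompletion K v)).injective
  have h4 : Valued.v (4 : adicCompletion K v) ≠ 0 := (Valuation.ne_zero_iff _).mpr (by norm_num)
  refine Filter.mem_of_superset (T5NormGroupOpen.setOf_val_sub_one_le_mem_nhds_one v
    (log (Valued.v (4 : adicCompletion K v)) - 1)) ?_
  intro u hu
  have hu' : Valued.v ((u : adicCompletion K v) - 1) < Valued.v (4 : adicCompletion K v) :=
    calc Valued.v ((u : adicCompletion K v) - 1) ≤ exp (log (Valued.v (4 : adicCompletion K v)) - 1) := hu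
      _ < exp (log (Valued.v (4 : adicCompletion K v))) := by rw [exp_lt_exp]; omega
      _ = Valued.v (4 : adicCompletion K v) := exp_log h4
  obtain ⟨y, rfl⟩ := exists_sq_eq_of_val_sub_one_lt_val_four v u hu'
  exact hH y

/-- A subgroup of `Kvˣ` containing every square is OPEN (the squares form an open subgroup). -/
theorem isOpen_of_forall_sq_mem (H : Subgroup (adicCompletion K v)ˣ)
    (hH : ∀ x : (adicCompletion K v)ˣ, x ^ 2 ∈ H) : IsOpen (H : Set (adicCompletion K v)ˣ) :=
  Subgroup.isOpen_of_mem_nhds _ (mem_nhds_one_of_forall_sq_mem v H hH)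

/-- EVERY INDEX-`2` SUBGROUP OF `Kvˣ` IS OPEN (it contains the squares, `Subgroup.sq_mem_of_index_two`). -/
theorem isOpen_of_index_two (H : Subgroup (adicCompletion K v)ˣ) (hH : H.index = 2) :
    IsOpen (H : Set (adicCompletion K v)ˣ) :=
  isOpen_of_forall_sq_mem v H (Subgroup.sq_mem_of_index_two hH)

/-- The sign character of an index-`2` subgroup of `Kvˣ` is continuous. -/
theorem continuous_signChar (H : Subgroup (adicCompletion K v)ˣ) (hH : H.index = 2) :
    Continuous (T5IndexTwoCharacter.signChar H hH) :=
  T5ProfiniteCharacterExtension.continuous_of_eq_one_on_open_subgroup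
    (T5IndexTwoCharacter.signChar H hH) H (isOpen_of_index_two v H hH)
    (fun _ hy => T5IndexTwoCharacter.signChar_apply_of_mem H hH hy)

/-- AUTOMATIC CONTINUITY: every homomorphism `χ : Kvˣ →* ℤˣ` is continuous (its kernel has index
`1` or `2`). -/
theorem continuous_of_index_two_ker (χ : (adicCompletion K v)ˣ →* ℤˣ) : Continuous χ := by
  have hdvd : Nat.card χ.range ∣ Nat.card ℤˣ := Subgroup.card_subgroup_dvd_card χ.range
  have h2 : Nat.card ℤˣ = 2 := by
    rw [Nat.card_eq_fintype_card]
    exact Fintype.card_units_int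
  rw [h2] at hdvd
  rcases (Nat.dvd_prime Nat.prime_two).mp hdvd with h1 | h1
  · -- trivial character
    have : χ = 1 := by
      ext g
      have hg : χ g ∈ χ.range := ⟨g, rfl⟩
      have hsub : Subsingleton χ.range := Finite.card_le_one_iff_subsingleton.mp h1.le
      have h1' : (⟨χ g, hg⟩ : χ.range) = ⟨1, one_mem _⟩ := Subsingleton.elim _ _
      simpa using congrArg Subtype.val h1'
    rw [this]
    exact continuous_const
  · have hk : χ.ker.index = 2 := by rw [Subgroup.index_ker, h1]
    exact T5ProfiniteCharacterExtension.continuous_of_eq_one_on_open_subgroup χ χ.ker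
      (isOpen_of_index_two v χ.ker hk) (fun _ hy => hy)

end Summit.Ventures.HodgeRepro2.T5QuadraticCharactersContinuous
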